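/-
  Summits/AtomisticToContinuum/Crystallization/Theorems/OverbindingBudgetAffineFarFirstShellLabelling.lean

  residual stmt-AtomisticToContinuum-31280 · slot Z `FarAggregatePricing 12 (1/25) (1/2000) (1/(2·10⁷))` · leaf LAB′ `ShelteredLabelling'`
  (…FarSlotRecord §3, rank 2 of leaf list v13′, critic row 877 (ii)(b)/(iii)): THE FIRST-SHELL RE-TYPING LAB₁′ with the slot record v14′;
  decomp-a2c lens-4 «minimal counterexample / extremal reduction», generation 56.
  Imports ONLY the tree file `…OverbindingBudgetAffineFarSlotRecord` and `…OverbindingBudgetAffineFarFirstShellDrift` (DRIFT₁, this generation).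
  0 sorry · 0 axiom · no instance · no notation · no option.
-/
import Summits.AtomisticToContinuum.Crystallization.Theorems.OverbindingBudgetAffineFarSlotRecord
import Summits.AtomisticToContinuum.Crystallization.Theorems.OverbindingBudgetAffineFarFirstShellDrift

/-! # LAB₁′: sheltered labelling with FIRST-SHELL fits, and the slot record v14′

THESIS.  The leaf LAB′ `ShelteredLabelling' θ θ₀` (…FarSlotRecord) asks the labelling engine for local affine fits `L k` on LABEL RADIUS `2`
around every interior label (`‖π k' − π k‖ ≤ 2 ⇒ ‖y k' − y k − L k (π k' − π k)‖ ≤ c₀ε₁nn_i`).  The only consumer of these fits is the drift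
integration DRIFT, and DRIFT holds from FIRST-SHELL fits alone (`labelDriftBound₁_holds`, …FarFirstShellDrift: every contact edge of a close
packing lies in a regular tetrahedron of touching balls, so two touching sites are compared through COMMON touching neighbours).  Hence:

* LAB₁′ · `ShelteredShellLabelling' θ θ₀` [NEW LEAF · TRUE-type · ATTACKABLE-M · replaces LAB′ at rank 2]: LAB′ VERBATIM with the fit clause
  restricted to `‖π k' − π k‖ ≤ 1` — the engine owes, at each interior site `k`, ONE linear map fitting the (at most twelve) labelled sites
  TOUCHING `π k` in the stacking.  These are exactly the sites where the two objects the engine must marry coincide cleanly: the site's OWN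
  two-shell frame (`AffFramed ε₁ θ (1/450) y k`: first shell at `(1 ± (θ+ε₁))·nn_k`, the fit `nn_k • A_k` to accuracy `ε₁nn_k`) and the stacking
  labels (first stacking shell = norm-`1` label differences); at label radius `2` the frame's second shell (`√2`) covers only 6 of the 54
  labels and the remaining 36 would need a separate relabelling argument (third/fourth stacking shells `√(8/3), √3, √(11/3), 2` are NOT pattern
  points).  So the re-typing removes an obligation that the natural mechanism (local frame + pattern-relabelling rigidity, memo NODE-g56 §2)
  does not deliver, without moving any difficulty elsewhere: DRIFT₁ is proved.
* `ShelteredLabelling' → ShelteredShellLabelling'` (`shelteredShellLabelling'_of_labelling'`, PROVED: fewer fit obligations) — LAB₁′ is WEAKER.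
* GLUE (PROVED) `shelteredMatching_of_shellLabelling' : ShelteredShellLabelling' θ θ₀ → AffineChartStraightening' → ShelteredMatching θ θ₀` —
  the glue of …FarMatchingSplit §2 verbatim (`λ := λ`, `C₁ := C₁ + 8D₀c₀λ'²`, `D := 8D₀c₀`, `ε_M := min ε_L (1/(8D₀c₀+1))`, matching class =
  the labels `2` inside the stacking ball) with DRIFT₁ in place of DRIFT; R_aff′ is passed to LAB₁′ (SM's own premise R_aff is not usable
  at `θ = 1/25`, finding F-θ).
* ★ RECORD v14′ `farAggregatePricing_record_of_leaves_v14'`: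
  `AffineChartStraightening' → FarCoreExcess → ShelteredFarCharting' → NormalCorePricing → TailDriftBound → ShelteredShellLabelling' → ScaleBadFloor
  → FarAggregatePricing 12 (1/25) (1/2000) (1/(2·10⁷))` — leaf list v14′ = R_aff′ (M, shared) · Z2 (CERT) · Zr‴a′ (M) · Zr‴b (S) · Z3a (S/M) ·
  LAB₁′ (M · rank 2) · Z4″ (M+CERT); v13′ with LAB′ replaced by the weaker LAB₁′.
WHY LAB₁′ IS STRICTLY WEAKER THAN LAB′ (as typed).  LAB′ ⇒ LAB₁′ is restriction.  Conversely LAB₁′ gives radius-`1` fits only at labels with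
margin `2`; radius-`2` fits at such a label `k` would need radius-`1` fits at the neighbours of `k`, which have margin `1` only and are not
covered — no formal converse without re-running the engine with a larger `ρ` (which is LAB′ itself).
WHY NOVEL (vs LAB/LAB′, …FarMatchingSplit/…FarSlotRecord): not a restatement — an obligation is DELETED from the rank-2 leaf and its former
role is discharged by a proved generic lemma (DRIFT₁) with new geometric content (tetrahedral companions + unit-frame operator bound); the
leaf count and every other leaf are unchanged.
HIDDEN-GAUGE / DEGENERATE AUDIT: as LAB′ (the ∀-chart enters only through `Recharts θ c c'` and `L i = c'.a₀ • c'.B`; `ρ ≥ 2` forced by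
`‖π i‖ + 2 ≤ ρ`; `M = {i}` contradicts surjectivity; `L k := 0` violates the first-shell fits since touching sites are `nn`-separated; the fit
clause at `k' = k` reads `0 ≤ c₀ε₁nn_i`).
-/

namespace Summit.AtomisticToContinuum.Crystallization.Theorems.OverbindingBudgetAffineFarSmoothSplit

open scoped BigOperators Classical
open Literature.MathematicalPhysics.StatisticalMechanics
open Literature.Geometry.DiscreteGeometry (nearestDist nearestDist_nonneg nearestDist_le_dist)
open Summit.AtomisticToContinuum.Crystallization.Theorems.OverbindingBudgetBalancedCensusStatements
open Summit.AtomisticToContinuum.Crystallization.Theorems.OverbindingBudgetAffineLadder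
open Summit.AtomisticToContinuum.Crystallization.Theorems.OverbindingBudgetAffineLocalisation

/-! ## §1  The re-typed leaf LAB₁′ -/

/-- **LAB₁′ · `ShelteredShellLabelling' θ θ₀`** (NEW LEAF · TRUE-type · ATTACKABLE-M · rank 2; the first-shell re-typing of LAB′
`ShelteredLabelling'`, critic row 877): LAB′ VERBATIM — behind the premise `AffineChartStraightening'`, for a normal far row `i` with an
admissible `Cε₁`-exact chart `c` and a defect-free `λR·nn_i`-ball (`C₁ε₁R² ≤ 1`): a rechart `c'` of `c`, a finite class `M ⊆ G` with `i ∈ M`,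
an injective labelling `π : M → barlowStacking 1 √(2/3) c'.s` (`π i = 0`) with `‖π k‖ ≤ ρ ≤ λ'R`, `‖π k‖ ≤ 2 r_{ik}/nn_i + 1`, onto the stacking
ball of radius `ρ`, every good site within `R·nn_i` labelled `2` inside, `L i = c'.a₀ • c'.B` — EXCEPT that the local affine fits are owed on
LABEL RADIUS `1` only: `‖π k‖ + 2 ≤ ρ → ‖π k' − π k‖ ≤ 1 → ‖y k' − y k − L k (π k' − π k)‖ ≤ c₀ε₁nn_i`.  Why it might fail: only as LAB′ —
if a `(1/25)`-framed, `(1/450)`-gapped sheltered ball admitted two stacking readings (excluded while the adjacent-frame transition maps stay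
within `√2` of an isometry: `θ < 1/12`, memo THETA-g56) or the core rechart failed (`Recharts` is `Cε₁`-rigid on the `44/5·nn` ball).
[memo NODE-g56 §1–§2; HalesDSP2012 §1.3; FJM 2002; critic row 877] -/
def ShelteredShellLabelling' (θ θ₀ : ℝ) : Prop :=
  AffineChartStraightening' → ∀ C : ℝ, 0 ≤ C → ∃ lam lam' C₁ c₀ εL : ℝ, 1 ≤ lam ∧ 1 ≤ lam' ∧ 0 < C₁ ∧ 0 ≤ c₀ ∧ 0 < εL ∧
    ∀ ε₁ : ℝ, 0 < ε₁ → ε₁ ≤ εL → ∀ δ : ℝ, 0 < δ → δ ≤ 2 →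
      ∀ (N : ℕ) (y : Fin N → EuclideanSpace ℝ (Fin 3)), Function.Injective y →
        ∀ i ∈ farSet θ₀ 12 ε₁ θ δ y \ goodScaleBadSet 12 ε₁ θ δ y, ∀ c : Chart, IsChart C ε₁ y i c → ChartAdmissible θ c →
          ∀ R : ℝ, 1 ≤ R → C₁ * ε₁ * R ^ 2 ≤ 1 → Sheltered (lam * R) 12 ε₁ θ δ y i →
            ∃ (c' : Chart) (M : Finset (Fin N)) (π : Fin N → EuclideanSpace ℝ (Fin 3)) (ρ : ℝ)
              (L : Fin N → (EuclideanSpace ℝ (Fin 3) →ₗ[ℝ] EuclideanSpace ℝ (Fin 3))),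
              Recharts θ c c' ∧ M ⊆ goodSet 12 ε₁ θ δ y ∧ i ∈ M ∧ π i = 0 ∧ Set.InjOn π ↑M ∧
              (∀ k ∈ M, π k ∈ barlowStacking 1 (Real.sqrt (2 / 3)) c'.s ∧ ‖π k‖ ≤ ρ ∧
                ‖π k‖ ≤ 2 * (dist (y k) (y i) / nearestDist y i) + 1) ∧
              ρ ≤ lam' * R ∧
              (∀ k ∈ goodSet 12 ε₁ θ δ y, dist (y k) (y i) ≤ R * nearestDist y i → k ∈ M ∧ ‖π k‖ + 2 ≤ ρ) ∧
              (∀ p ∈ barlowStacking 1 (Real.sqrt (2 / 3)) c'.s, ‖p‖ ≤ ρ → ∃ k ∈ M, π k = p) ∧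
              L i = c'.a₀ • c'.B ∧
              ∀ k ∈ M, ‖π k‖ + 2 ≤ ρ → ∀ k' ∈ M, ‖π k' - π k‖ ≤ 1 →
                ‖y k' - y k - L k (π k' - π k)‖ ≤ c₀ * ε₁ * nearestDist y i

/-- **LAB′ ⇒ LAB₁′ (PROVED: the fit clause is restricted from label radius `2` to `1`).** [this file] -/
theorem shelteredShellLabelling'_of_labelling' {θ θ₀ : ℝ} (h : ShelteredLabelling' θ θ₀) : ShelteredShellLabelling' θ θ₀ := by
  intro hR' C hC
  obtain ⟨lam, lam', C₁, c₀, εL, hlam, hlam', hC₁, hc₀, hεL, H⟩ := h hR' C hC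
  refine ⟨lam, lam', C₁, c₀, εL, hlam, hlam', hC₁, hc₀, hεL, fun ε₁ hε₁ hε₁L δ hδ hδ2 N y hy i hi c hc hca R hR1 hCR hSh => ?_⟩
  obtain ⟨c', M, π, ρ, L, hrc, hMG, hiM, hπi, hinj, hlab, hρ, hcov, hsurj, hLi, hfit⟩ :=
    H ε₁ hε₁ hε₁L δ hδ hδ2 N y hy i hi c hc hca R hR1 hCR hSh
  exact ⟨c', M, π, ρ, L, hrc, hMG, hiM, hπi, hinj, hlab, hρ, hcov, hsurj, hLi,
    fun k hk hkρ k' hk' hkk' => hfit k hk hkρ k' hk' (hkk'.trans one_le_two)⟩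

/-- LAB ⇒ LAB₁′ (PROVED, via LAB′). [this file] -/
theorem shelteredShellLabelling'_of_labelling {θ θ₀ : ℝ} (h : ShelteredLabelling θ θ₀) : ShelteredShellLabelling' θ θ₀ :=
  shelteredShellLabelling'_of_labelling' (shelteredLabelling'_of h)

/-! ## §2  The glue (PROVED): SM ⟸ LAB₁′ ∧ R_aff′, by DRIFT₁ -/

/-- ★ **`ShelteredShellLabelling' ∧ AffineChartStraightening' ⇒ ShelteredMatching`** — the glue of …FarMatchingSplit §2 with DRIFT₁
(`labelDriftBound₁_holds`) integrating the first-shell fits: `λ := λ`, `C₁ := C₁ + 8D₀c₀λ'²`, `D := 8D₀c₀`, `ε_M := min ε_L (1/(8D₀c₀ + 1))`,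
matching class = the LAB₁′ sites whose label is `2` inside the stacking ball. [this file] -/
theorem shelteredMatching_of_shellLabelling' {θ θ₀ : ℝ} (hL : ShelteredShellLabelling' θ θ₀) (hR' : AffineChartStraightening') :
    ShelteredMatching θ θ₀ := by
  intro _ C hC
  obtain ⟨lam, lam', C₁, c₀, εL, hlam, hlam', hC₁, hc₀, hεL, hLAB⟩ := hL hR' C hC
  obtain ⟨D₀, hD₀, hDR⟩ := labelDriftBound₁_holds
  have hK : 0 ≤ D₀ * c₀ := mul_nonneg hD₀ hc₀
  refine ⟨lam, C₁ + 8 * (D₀ * c₀) * lam' ^ 2, 8 * (D₀ * c₀), min εL (1 / (8 * (D₀ * c₀) + 1)), hlam, by positivity, by positivity,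
    lt_min hεL (by positivity), fun ε₁ hε₁ hε₁le δ hδ hδ2 N y hy i hi c hc hca R hR1 hCR hSh => ?_⟩
  have hε₁L : ε₁ ≤ εL := hε₁le.trans (min_le_left _ _)
  have hε₁K : ε₁ ≤ 1 / (8 * (D₀ * c₀) + 1) := hε₁le.trans (min_le_right _ _)
  have hR0 : 0 ≤ R := by linarith
  have hεR : 0 ≤ ε₁ * R ^ 2 := by positivity
  have hsplit : (C₁ + 8 * (D₀ * c₀) * lam' ^ 2) * ε₁ * R ^ 2 = C₁ * (ε₁ * R ^ 2) + 8 * (D₀ * c₀) * lam' ^ 2 * (ε₁ * R ^ 2) := by ring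
  have hA : 0 ≤ C₁ * (ε₁ * R ^ 2) := mul_nonneg hC₁.le hεR
  have hB : 0 ≤ 8 * (D₀ * c₀) * lam' ^ 2 * (ε₁ * R ^ 2) := by positivity
  have hCR' : C₁ * ε₁ * R ^ 2 ≤ 1 := by rw [hsplit] at hCR; rw [mul_assoc]; linarith
  have hKR : 8 * (D₀ * c₀) * lam' ^ 2 * (ε₁ * R ^ 2) ≤ 1 := by rw [hsplit] at hCR; linarith
  obtain ⟨c', M, π, ρ, L, hrc, hMG, hiM, hπi, hinj, hlab, hρ, hcov, hsurj, hLi, hfit⟩ :=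
    hLAB ε₁ hε₁ hε₁L δ hδ hδ2 N y hy i hi c hc hca R hR1 hCR' hSh
  have hiG : i ∈ goodSet 12 ε₁ θ δ y := hMG hiM
  have hnn : 0 < nearestDist y i := lt_of_lt_of_le hδ (inWindow_of_mem_goodSet hiG).1
  have hη : 0 ≤ c₀ * ε₁ * nearestDist y i := by positivity
  have hs : IsHaggSeq c'.s := hrc.1.1
  have hdrift := hDR c'.s hs N y i M π ρ (c₀ * ε₁ * nearestDist y i) L hη hiM hπi hinj
    (fun k hk => ⟨(hlab k hk).1, (hlab k hk).2.1⟩) hsurj hfit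
  refine ⟨c', M.filter (fun k => ‖π k‖ + 2 ≤ ρ), π, hrc, (Finset.filter_subset _ _).trans hMG, ⟨?_, ?_⟩, ?_⟩
  · exact hinj.mono (by intro k hk; exact (Finset.mem_filter.mp hk).1)
  · intro k hk
    obtain ⟨hkM, hkρ⟩ := Finset.mem_filter.mp hk
    obtain ⟨hkS, hkle, hkr⟩ := hlab k hkM
    refine ⟨hkS, ?_⟩
    have hb := hdrift k hkM hkρ
    have e : dist (y k) (y i + c'.a₀ • c'.B (π k)) = ‖y k - y i - L i (π k)‖ := by
      rw [hLi, LinearMap.smul_apply, dist_eq_norm, sub_add_eq_sub_sub]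
    rw [e]
    refine hb.trans ?_
    set nn := nearestDist y i with hnn_def
    set r := dist (y i) (y k) with hr_def
    have hrk : dist (y k) (y i) = r := dist_comm _ _
    rw [hrk] at hkr
    have hu : 0 ≤ ‖π k‖ := norm_nonneg _
    -- quadratic branch
    have hq : 1 + ‖π k‖ ^ 2 ≤ 8 * (1 + (r / nn) ^ 2) := one_add_sq_le_eight_mul hu hkr
    have hquad : D₀ * (c₀ * ε₁ * nn) * (1 + ‖π k‖ ^ 2) ≤ 8 * (D₀ * c₀) * ε₁ * nn * (1 + (r / nn) ^ 2) := by
      have := mul_le_mul_of_nonneg_left hq (show 0 ≤ D₀ * (c₀ * ε₁ * nn) by positivity)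
      nlinarith
    -- cap branch
    have hKε : D₀ * c₀ * ε₁ ≤ 1 / 8 := by
      have h1 : D₀ * c₀ * ε₁ ≤ D₀ * c₀ * (1 / (8 * (D₀ * c₀) + 1)) := mul_le_mul_of_nonneg_left hε₁K hK
      have h2 : D₀ * c₀ * (1 / (8 * (D₀ * c₀) + 1)) ≤ 1 / 8 := by
        rw [mul_one_div, div_le_iff₀ (by positivity)]
        nlinarith
      exact h1.trans h2
    have hπρ : ‖π k‖ ^ 2 ≤ (lam' * R) ^ 2 := pow_le_pow_left₀ hu (hkle.trans hρ) 2
    have hKπ : D₀ * c₀ * ε₁ * ‖π k‖ ^ 2 ≤ 1 / 8 := by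
      have h1 : D₀ * c₀ * ε₁ * ‖π k‖ ^ 2 ≤ D₀ * c₀ * ε₁ * (lam' * R) ^ 2 :=
        mul_le_mul_of_nonneg_left hπρ (by positivity)
      have h2 : D₀ * c₀ * ε₁ * (lam' * R) ^ 2 = (8 * (D₀ * c₀) * lam' ^ 2 * (ε₁ * R ^ 2)) / 8 := by ring
      rw [h2] at h1
      linarith
    have hcap : D₀ * (c₀ * ε₁ * nn) * (1 + ‖π k‖ ^ 2) ≤ nn / 4 := by
      have h1 : D₀ * (c₀ * ε₁ * nn) * (1 + ‖π k‖ ^ 2) = nn * (D₀ * c₀ * ε₁ + D₀ * c₀ * ε₁ * ‖π k‖ ^ 2) := by ring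
      rw [h1]
      nlinarith
    exact le_min hquad hcap
  · intro k hk hkd
    obtain ⟨hkM, hkρ⟩ := hcov k hk hkd
    exact Finset.mem_filter.mpr ⟨hkM, hkρ⟩

/-- **NF ⟸ LAB₁′ ∧ R_aff′** (by the tree glue `nearFieldRechartLoss_of_shelteredMatching`). [this file] -/
theorem nearFieldRechartLoss_of_shellLabelling' {θ θ₀ : ℝ} (hL : ShelteredShellLabelling' θ θ₀) (hR' : AffineChartStraightening') :
    NearFieldRechartLoss θ θ₀ :=
  nearFieldRechartLoss_of_shelteredMatching (shelteredMatching_of_shellLabelling' hL hR')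

/-! ## §3  ★ Slot Z, record v14′ -/

/-- ★ **SLOT Z, RECORD v14′ (the first-shell re-typing of v13′)**:
`AffineChartStraightening' → FarCoreExcess → ShelteredFarCharting' → NormalCorePricing → TailDriftBound → ShelteredShellLabelling' → ScaleBadFloor →
FarAggregatePricing 12 (1/25) (1/2000) (1/(2·10⁷))` — R_aff′ (M, shared) · Z2 (CERT) · Zr‴a′ (M) · Zr‴b (S) · Z3a (S/M) · LAB₁′ (M · rank 2) ·
Z4″ (M+CERT). [this file] -/
theorem farAggregatePricing_record_of_leaves_v14' (hR' : AffineChartStraightening')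
    (h2 : FarCoreExcess (1 / 25) (1 / 2000) (1 / (2 * 10 ^ 7)))
    (hra' : ShelteredFarCharting' (1 / 25) (1 / 2000)) (hrb : NormalCorePricing (1 / 25))
    (h3a : TailDriftBound (1 / 25) (1 / 2000)) (hL₁ : ShelteredShellLabelling' (1 / 25) (1 / 2000))
    (h4 : ScaleBadFloor (1 / 25) (1 / (2 * 10 ^ 7))) :
    FarAggregatePricing 12 (1 / 25) (1 / 2000) (1 / (2 * 10 ^ 7)) :=
  farAggregatePricing_record_of_leaves_census h2 (shelteredFarCharting_of_prime hra' hR') hrb h3a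
    (shelteredMatching_of_shellLabelling' hL₁ hR') h4

/-- v13′ factors through v14′ (PROVED: LAB′ ⇒ LAB₁′) — the re-typing loses nothing. [this file] -/
theorem farAggregatePricing_record_of_leaves_v13'_via_v14' (hR' : AffineChartStraightening')
    (h2 : FarCoreExcess (1 / 25) (1 / 2000) (1 / (2 * 10 ^ 7)))
    (hra' : ShelteredFarCharting' (1 / 25) (1 / 2000)) (hrb : NormalCorePricing (1 / 25))
    (h3a : TailDriftBound (1 / 25) (1 / 2000)) (hL' : ShelteredLabelling' (1 / 25) (1 / 2000))
    (h4 : ScaleBadFloor (1 / 25) (1 / (2 * 10 ^ 7))) :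
    FarAggregatePricing 12 (1 / 25) (1 / 2000) (1 / (2 * 10 ^ 7)) :=
  farAggregatePricing_record_of_leaves_v14' hR' h2 hra' hrb h3a (shelteredShellLabelling'_of_labelling' hL') h4

end Summit.AtomisticToContinuum.Crystallization.Theorems.OverbindingBudgetAffineFarSmoothSplit
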